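import Literature.Analysis.OperatorTheory.PseudoResolventOperator
import Mathlib.Analysis.SpecialFunctions.Exponential
import Mathlib.Analysis.Calculus.MeanValue
import Mathlib.Analysis.Calculus.Deriv.Mul
import Mathlib.Analysis.Complex.RealDeriv
import HarnessLib

/-!
# The Hille–Yosida generation theorem (contraction case), part 1: exponentials of bounded
  operators and the Yosida approximation

Analysis/UnboundedOperators support file (one `structure` of hypotheses and one definition with
body, everything proved, no named facts). This is the first of three files proving the
**Hille–Yosida generation theorem** in the contraction case (Hille 1948, Yosida 1948; Engel–Nagel
(2000), Ch. II Thm. 3.5; Pazy (1983), Thm. 1.3.1; Kato (1966), IX-§1.2) for the tree's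
`C0Semigroup ℂ E` (`StrongContRepresentation.lean`), in the **pseudo-resolvent form** that the
tree's unbounded operators come in (`Literature.Analysis.OperatorTheory.IsPseudoResolvent`,
`operatorOfResolvent`, Kato VIII-§1.1):

  if `J : ℂ → E →L[ℂ] E` is a pseudo-resolvent on a set `U ⊇ (0, ∞)` with `‖J(λ)‖ ≤ 1/λ` for
  real `λ > 0` and dense range, then there is a contraction C₀-semigroup `T` on `E` whose Laplace
  transform is `J` (`∫₀^∞ e^{−λt} T(t)x dt = J(λ)x`), i.e. whose generator is the closed operator
  `A = operatorOfResolvent J` with `J(λ) = (λ − A)⁻¹`.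

Mathlib has no C₀-semigroup theory; the tree has the structure, the generator, its density and
closedness and the EASY half of Engel–Nagel II.1.10 (the Laplace transform of a semigroup is the
resolvent of its generator, `SemigroupLaplaceResolvent*.lean`), but not the generation theorem.

This file (Engel–Nagel II Lemma 3.4 and the first half of the proof of Thm. 3.5):
* §1 exponentials of bounded operators `exp (z • A)`, `A : E →L[ℂ] E` (Mathlib's `NormedSpace.exp`):
  `‖exp A‖ ≤ e^{‖A‖}`, `exp (B − c·1) = e^{−c} exp B`, **`‖exp (t(B − 1))‖ ≤ 1` for `‖B‖ ≤ 1`,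
  `t ≥ 0`**, derivative / continuity of `u ↦ exp (uA) x` in REAL time, and the key estimate
  **`‖exp (tA) x − exp (tB) x‖ ≤ t ‖Ax − Bx‖`** for commuting `A`, `B` with contractive
  exponentials (Engel–Nagel II (3.8); Pazy (1983) Lemma 1.3.? eq. (3.13));
* §2 the hypotheses `IsHilleYosidaData U J` and the **Yosida approximants**
  `yosida J λ = λ(λJ(λ) − 1) = λ²J(λ) − λ` (`= λ A (λ − A)⁻¹`, bounded), which commute, have
  contractive exponentials, satisfy `λJ(λ)x → x` (`λ → ∞`) for every `x`, hence
  `yosida J λ x → A x` on `D(A) = Ran J(1)` (where `A (J(1)y) = J(1)y − y`), and `J(z)` injective;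
* §3 the Cauchy estimate `‖exp (t Y_λ) x − exp (t Y_μ) x‖ ≤ t ‖Y_λ x − Y_μ x‖`.

Design: all exponentials are taken at COMPLEX multiples `(t : ℂ) • A` of the real time `t`, so
that only the `ℂ`-algebra structure of `E →L[ℂ] E` is used (no real-scalar diamonds); real
structures enter only on `E` itself (`NormedSpace.complexToReal`) for derivatives in real time.
Part 2 (`HilleYosidaSemigroup.lean`) builds the semigroup as the strong limit of `exp (t Y_λ)`;
part 3 (`HilleYosidaGenerator.lean`) identifies its Laplace transform with `J`.

## References

* K.-J. Engel, R. Nagel, *One-Parameter Semigroups for Linear Evolution Equations*, Springer GTM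
  194 (2000), Ch. II Lemma 3.4, Thm. 3.5 (Generation Theorem, contraction case) and its proof,
  eq. (3.7)–(3.9). [EngelNagel2000]
* T. Kato, *Perturbation Theory for Linear Operators* (1966), IX-§1.2 (generation theorem),
  VIII-§1.1 (pseudo-resolvents). [Kato1966]
* E. Hille, *Functional Analysis and Semi-Groups* (1948); K. Yosida, J. Math. Soc. Japan 1 (1948)
  15–21 (the original proofs; Yosida's is the one followed here).
-/

noncomputable section

open NormedSpace Filter Set Metric Literature.Analysis.OperatorTheory
open scoped Topology NNReal

namespace Literature.Analysis.UnboundedOperators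

namespace HilleYosida

variable {E : Type*} [NormedAddCommGroup E] [NormedSpace ℂ E] [CompleteSpace E]

/-! ### §1 Exponentials of bounded operators -/

section Exp

omit [CompleteSpace E] in
/-- `‖1‖ ≤ 1` for the identity operator (also on the trivial space). [folklore] -/
private theorem norm_one_le : ‖(1 : E →L[ℂ] E)‖ ≤ 1 := ContinuousLinearMap.norm_id_le

/-- `‖exp A‖ ≤ e^{‖A‖}` for a bounded operator (term-wise bound of the exponential series; the
constant term uses `‖1‖ ≤ 1`). [cite: EngelNagel2000, Ch. I Prop. 3.5] -/
theorem norm_exp_le (A : E →L[ℂ] E) : ‖exp A‖ ≤ Real.exp ‖A‖ := by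
  have hx := exp_series_hasSum_exp' (𝕂 := ℂ) A
  rw [← hx.tsum_eq]
  have hreal : HasSum (fun n : ℕ => ‖A‖ ^ n / (n.factorial : ℝ)) (Real.exp ‖A‖) := by
    have h := exp_series_hasSum_exp' (𝕂 := ℝ) ‖A‖
    rw [← Real.exp_eq_exp_ℝ] at h
    simpa [smul_eq_mul, div_eq_inv_mul] using h
  refine tsum_of_norm_bounded hreal fun n => ?_
  rw [norm_smul, norm_inv, Complex.norm_natCast, div_eq_inv_mul]
  rcases Nat.eq_zero_or_pos n with rfl | hn
  · simpa using norm_one_le (E := E)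
  · exact mul_le_mul_of_nonneg_left (norm_pow_le' A hn) (by positivity)

omit [CompleteSpace E] in
/-- `exp (c · 1) = e^c · 1` for a scalar `c`. [folklore] -/
private theorem exp_smul_one (c : ℂ) : exp (c • (1 : E →L[ℂ] E)) = Complex.exp c • (1 : E →L[ℂ] E) := by
  have h := algebraMap_exp_comm (𝔸 := E →L[ℂ] E) c
  rw [Algebra.algebraMap_eq_smul_one, Algebra.algebraMap_eq_smul_one,
    show NormedSpace.exp c = Complex.exp c from (congrFun Complex.exp_eq_exp_ℂ c).symm] at h
  exact h.symm

/-- `exp (B − c·1) = e^{−c} · exp B`. [folklore] -/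
private theorem exp_sub_smul_one (B : E →L[ℂ] E) (c : ℂ) :
    exp (B - c • (1 : E →L[ℂ] E)) = Complex.exp (-c) • exp B := by
  letI : NormedAlgebra ℚ (E →L[ℂ] E) := .restrictScalars ℚ ℂ _
  have hcomm : Commute B (-(c • (1 : E →L[ℂ] E))) :=
    ((Commute.one_right B).smul_right c).neg_right
  rw [sub_eq_add_neg, exp_add_of_commute hcomm, ← neg_smul, exp_smul_one, mul_smul_comm, mul_one]

/-- **Contractivity of `exp (t(B − 1))`**: if `‖B‖ ≤ 1` and `t ≥ 0` then `‖exp (t(B − 1))‖ ≤ 1`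
(`= e^{−t}‖exp (tB)‖ ≤ e^{−t}e^{t‖B‖}`; Engel–Nagel II (3.7) for the Yosida approximants).
[cite: EngelNagel2000, Ch. II Thm. 3.5 proof, (3.7)] -/
theorem norm_exp_smul_sub_one_le {B : E →L[ℂ] E} (hB : ‖B‖ ≤ 1) {t : ℝ} (ht : 0 ≤ t) :
    ‖exp ((t : ℂ) • (B - 1))‖ ≤ 1 := by
  have h1 : (t : ℂ) • (B - 1) = (t : ℂ) • B - (t : ℂ) • (1 : E →L[ℂ] E) := smul_sub _ _ _
  rw [h1, exp_sub_smul_one]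
  calc ‖Complex.exp (-(t : ℂ)) • exp ((t : ℂ) • B)‖
      = Real.exp (-t) * ‖exp ((t : ℂ) • B)‖ := by
        rw [norm_smul, Complex.norm_exp]
        simp
    _ ≤ Real.exp (-t) * Real.exp ‖(t : ℂ) • B‖ :=
        mul_le_mul_of_nonneg_left (norm_exp_le _) (Real.exp_pos _).le
    _ ≤ Real.exp (-t) * Real.exp t := by
        refine mul_le_mul_of_nonneg_left (Real.exp_le_exp.2 ?_) (Real.exp_pos _).le
        rw [norm_smul, Complex.norm_real, Real.norm_eq_abs, abs_of_nonneg ht]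
        exact (mul_le_mul_of_nonneg_left hB ht).trans (by rw [mul_one])
    _ = 1 := by rw [← Real.exp_add, neg_add_cancel, Real.exp_zero]

/-- `z ↦ exp (zA) x` has complex derivative `(exp (zA) A) x` (`d/dt e^{tA} = e^{tA}A`).
[cite: EngelNagel2000, Ch. I Prop. 3.5] -/
theorem hasDerivAt_exp_smul_apply (A : E →L[ℂ] E) (x : E) (z : ℂ) :
    HasDerivAt (fun u : ℂ => exp (u • A) x) ((exp (z • A) * A) x) z := by
  have h := (hasDerivAt_exp_smul_const A z).clm_apply (hasDerivAt_const z x)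
  simpa using h

omit [CompleteSpace E] in
/-- Restriction of a complex derivative to real time (for `E`-valued maps). [folklore] -/
private theorem hasDerivAt_ofReal_comp {G : ℂ → E} {G' : E} {s : ℝ} (h : HasDerivAt G G' (s : ℂ)) :
    HasDerivAt (fun u : ℝ => G (u : ℂ)) G' s := by
  have h2 := h.scomp s (Complex.ofRealCLM.hasDerivAt)
  simpa [Function.comp_def] using h2

/-- `u ↦ exp (uA) x` (real `u`) has derivative `(exp (uA) A) x` (`d/dt e^{tA} = e^{tA}A` in real
time). [cite: EngelNagel2000, Ch. I Prop. 3.5] -/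
theorem hasDerivAt_exp_ofReal_smul_apply (A : E →L[ℂ] E) (x : E) (u : ℝ) :
    HasDerivAt (fun v : ℝ => exp ((v : ℂ) • A) x) ((exp ((u : ℂ) • A) * A) x) u :=
  hasDerivAt_ofReal_comp (hasDerivAt_exp_smul_apply A x u)

/-- `u ↦ exp (uA) x` (real `u`) is continuous (`(e^{tA})` is a (uniformly, hence strongly)
continuous semigroup). [cite: EngelNagel2000, Ch. I Prop. 3.5] -/
theorem continuous_exp_ofReal_smul_apply (A : E →L[ℂ] E) (x : E) :
    Continuous fun v : ℝ => exp ((v : ℂ) • A) x :=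
  continuous_iff_continuousAt.2 fun u => (hasDerivAt_exp_ofReal_smul_apply A x u).continuousAt

omit [CompleteSpace E] in
/-- An operator commuting with `B` commutes with `exp (zB)`. [folklore] -/
private theorem commute_exp_smul {A B : E →L[ℂ] E} (h : Commute A B) (z : ℂ) : Commute A (exp (z • B)) :=
  (h.smul_right z).exp_right

/-- **The key estimate** (Engel–Nagel II (3.9); Pazy (1983) (3.13) in the proof of Thm. 1.3.1):
for COMMUTING bounded operators `A`, `B` whose exponentials are contractions in positive time,
`‖exp (tA) x − exp (tB) x‖ ≤ t ‖A x − B x‖` (`t ≥ 0`). Proof: the real function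
`u ↦ exp (uA) exp ((t − u)B) x` has derivative `exp (uA) exp ((t − u)B) (Ax − Bx)` of norm
`≤ ‖Ax − Bx‖` on `[0, t]`; mean value inequality. [cite: EngelNagel2000, Ch. II Thm. 3.5 proof, (3.9)] -/
theorem norm_exp_sub_exp_apply_le {A B : E →L[ℂ] E} (hAB : Commute A B)
    (hA : ∀ s : ℝ, 0 ≤ s → ‖exp ((s : ℂ) • A)‖ ≤ 1) (hB : ∀ s : ℝ, 0 ≤ s → ‖exp ((s : ℂ) • B)‖ ≤ 1)
    {t : ℝ} (ht : 0 ≤ t) (x : E) :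
    ‖exp ((t : ℂ) • A) x - exp ((t : ℂ) • B) x‖ ≤ t * ‖A x - B x‖ := by
  -- the interpolating path and its derivative
  set φ : ℝ → E := fun u => exp ((u : ℂ) • A) (exp (((t - u : ℝ) : ℂ) • B) x) with hφ
  set φ' : ℝ → E := fun u => exp ((u : ℂ) • A) (exp (((t - u : ℝ) : ℂ) • B) (A x - B x)) with hφ'
  have hderiv : ∀ u : ℝ, HasDerivAt φ (φ' u) u := by
    intro u
    -- complex path `z ↦ exp (zA) (exp ((t − z)B) x)`
    have hin : HasDerivAt (fun z : ℂ => exp (((t : ℂ) - z) • B) x)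
        ((-1 : ℂ) • ((exp (((t : ℂ) - u) • B) * B) x)) (u : ℂ) := by
      have hlin : HasDerivAt (fun z : ℂ => (t : ℂ) - z) (-1 : ℂ) (u : ℂ) := by
        simpa using (hasDerivAt_id (u : ℂ)).const_sub (t : ℂ)
      have h := (hasDerivAt_exp_smul_apply B x ((t : ℂ) - u)).scomp (u : ℂ) hlin
      simpa [Function.comp_def] using h
    have hout := (hasDerivAt_exp_smul_const A (u : ℂ)).clm_apply hin
    have hreal := hasDerivAt_ofReal_comp (G := fun z : ℂ => exp (z • A) (exp (((t : ℂ) - z) • B) x))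
      (s := u) hout
    have hφu : (fun v : ℝ => exp ((v : ℂ) • A) (exp (((t : ℂ) - (v : ℂ)) • B) x)) = φ := by
      funext v; simp only [hφ, Complex.ofReal_sub]
    rw [hφu] at hreal
    refine hreal.congr_deriv ?_
    -- algebra: `exp(uA) A exp((t-u)B) x − exp(uA) exp((t-u)B) B x = exp(uA) exp((t-u)B) (Ax − Bx)`
    have hc : Commute A (exp (((t : ℂ) - (u : ℂ)) • B)) := commute_exp_smul hAB _
    simp only [hφ', Complex.ofReal_sub, mul_apply_eq_comp, neg_one_smul, map_sub, map_neg]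
    rw [show A (exp (((t : ℂ) - (u : ℂ)) • B) x) = exp (((t : ℂ) - (u : ℂ)) • B) (A x) from
      congrArg (fun T : E →L[ℂ] E => T x) hc.eq]
    abel
  -- derivative bound on `[0, t]`
  have hbound : ∀ u ∈ Ico (0 : ℝ) t, ‖φ' u‖ ≤ ‖A x - B x‖ := by
    intro u hu
    have h1 := hA u hu.1
    have h2 := hB (t - u) (sub_nonneg.2 hu.2.le)
    calc ‖φ' u‖ ≤ ‖exp ((u : ℂ) • A)‖ * ‖exp (((t - u : ℝ) : ℂ) • B) (A x - B x)‖ :=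
          ContinuousLinearMap.le_opNorm _ _
      _ ≤ 1 * (‖exp (((t - u : ℝ) : ℂ) • B)‖ * ‖A x - B x‖) :=
          mul_le_mul h1 (ContinuousLinearMap.le_opNorm _ _) (norm_nonneg _) zero_le_one
      _ ≤ 1 * (1 * ‖A x - B x‖) := by gcongr
      _ = ‖A x - B x‖ := by ring
  have hmvt := norm_image_sub_le_of_norm_deriv_le_segment' (f := φ) (f' := φ') (a := 0) (b := t)
    (fun u _ => (hderiv u).hasDerivWithinAt) hbound t (right_mem_Icc.2 ht)
  have hφt : φ t = exp ((t : ℂ) • A) x := by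
    simp only [hφ, sub_self, Complex.ofReal_zero, zero_smul, exp_zero, one_apply_eq_self]
  have hφ0 : φ 0 = exp ((t : ℂ) • B) x := by
    simp only [hφ, sub_zero, Complex.ofReal_zero, zero_smul, exp_zero, one_apply_eq_self]
  rw [hφt, hφ0, sub_zero] at hmvt
  calc ‖exp ((t : ℂ) • A) x - exp ((t : ℂ) • B) x‖ ≤ ‖A x - B x‖ * t := hmvt
    _ = t * ‖A x - B x‖ := mul_comm _ _

/-- The case `B = 0` of the key estimate: `‖exp (tA) x − x‖ ≤ t ‖A x‖`. [cite: EngelNagel2000, Ch. II Thm. 3.5 proof] -/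
theorem norm_exp_apply_sub_self_le {A : E →L[ℂ] E} (hA : ∀ s : ℝ, 0 ≤ s → ‖exp ((s : ℂ) • A)‖ ≤ 1)
    {t : ℝ} (ht : 0 ≤ t) (x : E) : ‖exp ((t : ℂ) • A) x - x‖ ≤ t * ‖A x‖ := by
  have h := norm_exp_sub_exp_apply_le (Commute.zero_right A) hA
    (fun s _ => by rw [smul_zero, exp_zero]; exact norm_one_le) ht x
  simpa using h

end Exp

/-! ### §2 Hille–Yosida data and the Yosida approximants -/

/-- **Hille–Yosida data (contraction case, pseudo-resolvent form).** A family
`J : ℂ → E →L[ℂ] E` which is a pseudo-resolvent (Kato VIII-(1.2): `J z − J w = (w − z) J z J w`)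
on a set `U` containing the positive reals, with the Hille–Yosida bound `‖J(λ)‖ ≤ λ⁻¹` for real
`λ > 0` and DENSE range (equivalently: densely defined generator). These are exactly the
hypotheses of Engel–Nagel (2000), Ch. II Thm. 3.5 (b) for the operator `A = operatorOfResolvent J`
(`J(λ) = (λ − A)⁻¹`): closedness is automatic (Kato VIII-§1.1) and injectivity of `J` follows
(`IsHilleYosidaData.injective`). [cite: EngelNagel2000, Ch. II Thm. 3.5] -/
structure IsHilleYosidaData (U : Set ℂ) (J : ℂ → E →L[ℂ] E) : Prop where
  /-- the resolvent identity on `U` -/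
  pseudo : IsPseudoResolvent U J
  /-- `U` contains the positive real axis -/
  mem : ∀ l : ℝ, 0 < l → (l : ℂ) ∈ U
  /-- the Hille–Yosida bound `‖λ J(λ)‖ ≤ 1` -/
  norm_le : ∀ l : ℝ, 0 < l → ‖J l‖ ≤ l⁻¹
  /-- the common range of the `J(z)` (the domain of the generator) is dense -/
  dense : Dense (Set.range (J 1))

/-- **The Yosida approximant** `Y_λ = λ(λJ(λ) − 1) = λ²J(λ) − λ` (`= λAR(λ, A) = A J_λ` in
Engel–Nagel's notation, a bounded operator). [cite: EngelNagel2000, Ch. II Lemma 3.4 / (3.6)] -/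
def yosida (J : ℂ → E →L[ℂ] E) (l : ℝ) : E →L[ℂ] E := (l : ℂ) • ((l : ℂ) • J l - 1)

namespace IsHilleYosidaData

variable {U : Set ℂ} {J : ℂ → E →L[ℂ] E}

omit [CompleteSpace E] in
/-- The `J(λ)` commute. [cite: Kato1966, VIII-§1.1] -/
theorem commute (h : IsHilleYosidaData U J) {l m : ℝ} (hl : 0 < l) (hm : 0 < m) :
    Commute (J l) (J m) :=
  h.pseudo.comm (h.mem l hl) (h.mem m hm)

omit [CompleteSpace E] in
/-- A Yosida approximant commutes with every `J(μ)`. [cite: EngelNagel2000, Ch. II Lemma 3.4] -/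
theorem commute_yosida_resolvent (h : IsHilleYosidaData U J) {l m : ℝ} (hl : 0 < l) (hm : 0 < m) :
    Commute (yosida J l) (J m) := by
  have hc := h.commute hl hm
  exact (((hc.smul_left (l : ℂ)).sub_left (Commute.one_left _)).smul_left (l : ℂ))

omit [CompleteSpace E] in
/-- The Yosida approximants commute. [cite: EngelNagel2000, Ch. II Lemma 3.4] -/
theorem commute_yosida (h : IsHilleYosidaData U J) {l m : ℝ} (hl : 0 < l) (hm : 0 < m) :
    Commute (yosida J l) (yosida J m) := by
  have hc := h.commute_yosida_resolvent hl hm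
  exact (((hc.smul_right (m : ℂ)).sub_right (Commute.one_right _)).smul_right (m : ℂ))

omit [CompleteSpace E] in
/-- `‖λ J(λ)‖ ≤ 1`. [cite: EngelNagel2000, Ch. II Thm. 3.5] -/
theorem norm_smul_resolvent_le (h : IsHilleYosidaData U J) {l : ℝ} (hl : 0 < l) :
    ‖(l : ℂ) • J l‖ ≤ 1 := by
  rw [norm_smul, Complex.norm_real, Real.norm_eq_abs, abs_of_pos hl]
  calc l * ‖J l‖ ≤ l * l⁻¹ := mul_le_mul_of_nonneg_left (h.norm_le l hl) hl.le
    _ = 1 := mul_inv_cancel₀ hl.ne'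

omit [CompleteSpace E] in
/-- `‖λ J(λ) x‖ ≤ ‖x‖`. [cite: EngelNagel2000, Ch. II Thm. 3.5] -/
theorem norm_smul_resolvent_apply_le (h : IsHilleYosidaData U J) {l : ℝ} (hl : 0 < l) (x : E) :
    ‖(l : ℂ) • J l x‖ ≤ ‖x‖ := by
  have := ((l : ℂ) • J l).le_of_opNorm_le (h.norm_smul_resolvent_le hl) x
  simpa using this

/-- **The exponentials of the Yosida approximants are contractions**: `‖exp (t Y_λ)‖ ≤ 1` for
`t ≥ 0`, `λ > 0`. [cite: EngelNagel2000, Ch. II Thm. 3.5 proof, (3.7)] -/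
theorem norm_exp_yosida_le (h : IsHilleYosidaData U J) {l : ℝ} (hl : 0 < l) {t : ℝ} (ht : 0 ≤ t) :
    ‖exp ((t : ℂ) • yosida J l)‖ ≤ 1 := by
  have heq : (t : ℂ) • yosida J l = ((t * l : ℝ) : ℂ) • ((l : ℂ) • J l - 1) := by
    rw [yosida, smul_smul, Complex.ofReal_mul]
  rw [heq]
  exact norm_exp_smul_sub_one_le (h.norm_smul_resolvent_le hl) (mul_nonneg ht hl.le)

omit [CompleteSpace E] in
/-- `λJ(λ)x − x = J(λ)(x − y)` for `x = J(1)y` (the resolvent identity between `λ` and `1`; this is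
`λJ(λ)x − x = J(λ)(Ax)` with `Ax = x − y`). [cite: EngelNagel2000, Ch. II Lemma 3.4 (i)] -/
theorem smul_resolvent_apply_sub (h : IsHilleYosidaData U J) {l : ℝ} (hl : 0 < l) (y : E) :
    (l : ℂ) • J l (J 1 y) - J 1 y = J l (J 1 y - y) := by
  have hid := h.pseudo (h.mem l hl) (h.mem 1 one_pos)
  -- `J l - J 1 = (1 - l) • (J l * J 1)`, applied to `y`
  have happ : J l y - J 1 y = (1 - (l : ℂ)) • J l (J 1 y) := by
    have := congrArg (fun T : E →L[ℂ] E => T y) hid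
    simpa only [sub_apply, smul_apply, mul_apply_eq_comp, Complex.ofReal_one] using this
  have h2 : (l : ℂ) • J l (J 1 y) = J l (J 1 y) - (J l y - J 1 y) := by
    rw [happ, sub_smul, one_smul]; abel
  rw [map_sub, h2]; abel

omit [CompleteSpace E] in
/-- **`λ J(λ) x → x` as `λ → ∞`, for every `x`** (first on the dense range, where
`‖λJ(λ)x − x‖ = ‖J(λ)(x − y)‖ ≤ ‖x − y‖/λ`, then by density and `‖λJ(λ)‖ ≤ 1`).
[cite: EngelNagel2000, Ch. II Lemma 3.4 (i)] -/
theorem tendsto_smul_resolvent_apply (h : IsHilleYosidaData U J) (x : E) :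
    Tendsto (fun l : ℝ => (l : ℂ) • J l x) atTop (𝓝 x) := by
  rw [Metric.tendsto_atTop]
  intro ε hε
  -- approximate `x` by an element of the range of `J 1`
  obtain ⟨x', hx'mem, hx'⟩ : ∃ x' ∈ Set.range (J 1), dist x x' < ε / 3 :=
    Metric.mem_closure_iff.1 (h.dense x) (ε / 3) (by positivity)
  obtain ⟨y, rfl⟩ := hx'mem
  -- on the range: `‖λJ(λ)x' − x'‖ ≤ ‖x' − y‖ / λ`
  set C : ℝ := ‖J 1 y - y‖ with hC
  obtain ⟨N, hN⟩ : ∃ N : ℝ, 0 < N ∧ C / N < ε / 3 := by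
    refine ⟨3 * C / ε + 1, by positivity, ?_⟩
    rw [div_lt_iff₀ (by positivity)]
    have : ε / 3 * (3 * C / ε + 1) = C + ε / 3 := by field_simp
    rw [this]; linarith
  refine ⟨N, fun l hl => ?_⟩
  have hl0 : 0 < l := hN.1.trans_le hl
  have h1 : ‖(l : ℂ) • J l (J 1 y) - J 1 y‖ ≤ C / l := by
    rw [h.smul_resolvent_apply_sub hl0, hC]
    calc ‖J l (J 1 y - y)‖ ≤ ‖J l‖ * ‖J 1 y - y‖ := ContinuousLinearMap.le_opNorm _ _
      _ ≤ l⁻¹ * ‖J 1 y - y‖ := mul_le_mul_of_nonneg_right (h.norm_le l hl0) (norm_nonneg _)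
      _ = ‖J 1 y - y‖ / l := by rw [inv_mul_eq_div]
  have h2 : C / l ≤ C / N := div_le_div_of_nonneg_left (norm_nonneg _) hN.1 hl
  have h3 : ‖(l : ℂ) • J l (x - J 1 y)‖ ≤ ‖x - J 1 y‖ := h.norm_smul_resolvent_apply_le hl0 _
  rw [dist_eq_norm] at hx' ⊢
  calc ‖(l : ℂ) • J l x - x‖
      = ‖(l : ℂ) • J l (x - J 1 y) + ((l : ℂ) • J l (J 1 y) - J 1 y) + (J 1 y - x)‖ := by
        congr 1; simp only [map_sub, smul_sub]; abel
    _ ≤ ‖(l : ℂ) • J l (x - J 1 y)‖ + ‖(l : ℂ) • J l (J 1 y) - J 1 y‖ + ‖J 1 y - x‖ :=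
        norm_add₃_le
    _ < ε / 3 + ε / 3 + ε / 3 :=
        add_lt_add_of_le_of_lt (add_le_add (h3.trans hx'.le) ((h1.trans h2).trans hN.2.le))
          (by rwa [norm_sub_rev])
    _ = ε := by ring

omit [CompleteSpace E] in
/-- **`J(z)` is injective** for `z ∈ U` (the kernel of a pseudo-resolvent is independent of `z`,
and on it `x = lim λJ(λ)x = 0`). [cite: Kato1966, VIII-§1.1] -/
theorem injective (h : IsHilleYosidaData U J) {z : ℂ} (hz : z ∈ U) : Function.Injective (J z) := by
  refine (injective_iff_map_eq_zero _).2 fun x hx => ?_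
  have hker : ∀ l : ℝ, 0 < l → J l x = 0 := by
    intro l hl
    have hmem : x ∈ LinearMap.ker (J z : E →ₗ[ℂ] E) := hx
    rw [h.pseudo.ker_eq hz (h.mem l hl)] at hmem
    exact hmem
  have hlim := h.tendsto_smul_resolvent_apply x
  have hzero : (fun l : ℝ => (l : ℂ) • J l x) =ᶠ[atTop] fun _ => (0 : E) := by
    filter_upwards [eventually_gt_atTop (0 : ℝ)] with l hl
    rw [hker l hl, smul_zero]
  have h0 : Tendsto (fun l : ℝ => (l : ℂ) • J l x) atTop (𝓝 0) := tendsto_const_nhds.congr' hzero.symm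
  exact tendsto_nhds_unique hlim h0

omit [CompleteSpace E] in
/-- **The Yosida approximant on the domain**: `Y_λ (J(1)y) = λJ(λ)(J(1)y − y)`, i.e.
`Y_λ x = λJ(λ)(Ax)` with `Ax = x − y` for `x = J(1)y`. [cite: EngelNagel2000, Ch. II Lemma 3.4 (ii)] -/
theorem yosida_apply_resolvent (h : IsHilleYosidaData U J) {l : ℝ} (hl : 0 < l) (y : E) :
    yosida J l (J 1 y) = (l : ℂ) • J l (J 1 y - y) := by
  simp only [yosida, smul_apply, sub_apply, one_apply_eq_self]
  rw [h.smul_resolvent_apply_sub hl]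

omit [CompleteSpace E] in
/-- Uniform bound on the domain: `‖Y_λ (J(1)y)‖ ≤ ‖J(1)y − y‖`. [cite: EngelNagel2000, Ch. II Lemma 3.4 (ii)] -/
theorem norm_yosida_apply_resolvent_le (h : IsHilleYosidaData U J) {l : ℝ} (hl : 0 < l) (y : E) :
    ‖yosida J l (J 1 y)‖ ≤ ‖J 1 y - y‖ := by
  rw [h.yosida_apply_resolvent hl]
  exact h.norm_smul_resolvent_apply_le hl _

omit [CompleteSpace E] in
/-- **Convergence of the Yosida approximants on the domain**: `Y_λ (J(1)y) → J(1)y − y`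
(`= A(J(1)y)`) as `λ → ∞`. [cite: EngelNagel2000, Ch. II Lemma 3.4 (ii)] -/
theorem tendsto_yosida_apply_resolvent (h : IsHilleYosidaData U J) (y : E) :
    Tendsto (fun l : ℝ => yosida J l (J 1 y)) atTop (𝓝 (J 1 y - y)) := by
  refine (h.tendsto_smul_resolvent_apply (J 1 y - y)).congr' ?_
  filter_upwards [eventually_gt_atTop (0 : ℝ)] with l hl
  rw [h.yosida_apply_resolvent hl]

/-! ### §3 The Cauchy estimate for the exponentials of the Yosida approximants -/

/-- **`‖exp (tY_λ) x − exp (tY_μ) x‖ ≤ t ‖Y_λ x − Y_μ x‖`** (`t ≥ 0`, `λ, μ > 0`): the key estimate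
for the commuting contractions `exp (tY_λ)`. [cite: EngelNagel2000, Ch. II Thm. 3.5 proof, (3.9)] -/
theorem norm_exp_yosida_sub_le (h : IsHilleYosidaData U J) {l m : ℝ} (hl : 0 < l) (hm : 0 < m)
    {t : ℝ} (ht : 0 ≤ t) (x : E) :
    ‖exp ((t : ℂ) • yosida J l) x - exp ((t : ℂ) • yosida J m) x‖ ≤
      t * ‖yosida J l x - yosida J m x‖ :=
  norm_exp_sub_exp_apply_le (h.commute_yosida hl hm) (fun _ hs => h.norm_exp_yosida_le hl hs)
    (fun _ hs => h.norm_exp_yosida_le hm hs) ht x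

/-- `‖exp (tY_λ) x − x‖ ≤ t ‖Y_λ x‖`. [cite: EngelNagel2000, Ch. II Thm. 3.5 proof] -/
theorem norm_exp_yosida_apply_sub_self_le (h : IsHilleYosidaData U J) {l : ℝ} (hl : 0 < l)
    {t : ℝ} (ht : 0 ≤ t) (x : E) : ‖exp ((t : ℂ) • yosida J l) x - x‖ ≤ t * ‖yosida J l x‖ :=
  norm_exp_apply_sub_self_le (fun _ hs => h.norm_exp_yosida_le hl hs) ht x

/-- `‖exp (tY_λ) x‖ ≤ ‖x‖`. [cite: EngelNagel2000, Ch. II Thm. 3.5 proof, (3.7)] -/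
theorem norm_exp_yosida_apply_le (h : IsHilleYosidaData U J) {l : ℝ} (hl : 0 < l) {t : ℝ}
    (ht : 0 ≤ t) (x : E) : ‖exp ((t : ℂ) • yosida J l) x‖ ≤ ‖x‖ := by
  have := (exp ((t : ℂ) • yosida J l)).le_of_opNorm_le (h.norm_exp_yosida_le hl ht) x
  simpa using this

end IsHilleYosidaData

end HilleYosida

end Literature.Analysis.UnboundedOperators
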